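/-
Copyright (c) 2026 the pub-hodgecm-mathlib formalisation cell (harness21).  Prover seat hodgecm-mathlib-K2E5-p17 (g9) (L1 hand dealt to S4 by chair VALVE 12 (c)),
R90-TF §S4 — FILE A of the (U2-UPG) payer road (S4 dealer K2E2-plan (g7) DEAL 2026-09-05T02:09:12Z (2)): the singular set of `U(Φ₂)(L⁺_v)` is Haar-null at EVERY
finite place.  THEOREMS ONLY (no `def`, no `instance`, no notation, no named-fact hypothesis, no `sorry`); NO `Lines` import.
-/
import Literature.NumberTheory.Rogawski1990.WeylVanishingSplitNonRegularNull                -- ★ torus averaging I `measure_setOf_not_separable_charpoly_eq_zero`, `continuous_diagUnit_two`, `measurable_of_eq_on_ne_zero`, `complexConj_smul_ne_of_exists`, `cm_antidiagTwo_map_transpose`, `cm_isUnit_det_antidiagTwo`, `localSplitEquiv`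
import Literature.NumberTheory.Rogawski1990.RegularOrbitalIntegralLocallyConstantCM           -- ★ `isRegularElt_iff_charpoly_separable_localNonsplitEquiv` (regularity = separability in the one-place model)
import Summits.HodgeConjecture.HodgeConjecture.Theorems.K2E3UnitarySingularLocusNullTwo     -- ★ p861160 `ae_isRegularElt_of_eq_over_two` (the one-place model at a non-split place; brings ★ `placeForm_antidiagTwo_eq`)
import Summits.HodgeConjecture.HodgeConjecture.Theorems.K2E3CharpolyDiscrInv                -- ★ `isRegularElt_inv_iff`
import Summits.HodgeConjecture.HodgeConjecture.Theorems.K2E3CharLocIntOfLocal               -- ★ `isOpen_setOf_isRegularElt_local`; brings ★ `LocalUnitaryGroupCongrMeasure` (instances on `(cmDatum L N H).Local v`)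
import Literature.Algebra.Polynomial.SeparablePi                                            -- ★ `separable_iff_forall_map_evalRingHom`
import HarnessLib

/-!
# R90-TF §S4 — (U2-UPG) FILE A: THE SINGULAR SET OF `U(Φ₂)(L⁺_v)` IS HAAR-NULL AT EVERY FINITE PLACE (Harish-Chandra 1970, Lemma 42)

Cell `hodgecm-mathlib`, crux item h413 = `stmt-HodgeConjecture-24833` (helper lane `--supports … --as helper`, count-neutral); R90-TF squad S4 (dealer K2E2-plan
(g7) DEAL 2026-09-05T02:09:12Z (2): «SPLIT `v`: the `GL₂(L_w)` discriminant hypersurface is Haar-null — the ONE missing S lemma»).  Consumer: FILE B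
`R90S4U2CharInvUpgrade` (the Borel ∕ everywhere-invariant upgrade of a character density needs `G^{reg}` CONULL).

THE MATHEMATICS.  `G = U(Φ₂)(L⁺_v) = (cmDatum L 2 Φ₂).Local v ≤ GL₂(∏_{w∣v} L_w)`, `g` regular iff `χ_g` is separable over the product ring, iff every component
`(χ_g)_{w′} = χ_{g_{w′}}` is separable (★ `separable_iff_forall_map_evalRingHom`).
* SPLIT `v` (§1): every `w′ ∣ v` is split (★ `complexConj_smul_ne_of_exists`) and `e_{w′} = localSplitEquiv : G ≃ₜ* GL₂(L_{w′})` is the `w′`-projection, so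
  `(χ_g)_{w′} = χ_{e_{w′} g}` (`rfl` + `Matrix.charpoly_map`); ★ TORUS AVERAGING I `measure_setOf_not_separable_charpoly_eq_zero` (right-invariant σ-finite `ν`,
  torus `s ↦ e⁻¹ diag(s, 1)`: along it `χ_{M diag(s,1)}` is non-separable only at the roots of a non-zero quadratic) kills each `{(χ_g)_{w′} not separable}`.  For a
  (left) HAAR measure `μ` apply this to the right-invariant `μ.inv` and use `{¬ regular}⁻¹ = {¬ regular}` (★ `isRegularElt_inv_iff`).
* NON-SPLIT `v` (§2): the one-place model `e : G ≃ₜ* U(σ_w, Φ₂)(L_w)` (★ `localNonsplitEquiv`), `e_* μ` Haar, ★ p861160 `ae_isRegularElt_of_eq_over_two` there, pulled back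
  (`ae_of_ae_map`) and read through ★ `isRegularElt_iff_charpoly_separable_localNonsplitEquiv`.
* §3 EVERY PLACE: **`measure_setOf_not_isRegularElt_u2Loc_eq_zero`** and the `∀ᵐ` form **`ae_isRegularElt_u2Loc`**.
HONEST LABEL.  Count-neutral helper: `HC_CM` is proved only modulo the 7 printed citations (2 remaining named inputs: hLiu418 = `stmt-HodgeConjecture-24832`,
h413 = `stmt-HodgeConjecture-24833`) until rung 0 closes; this file pays no socket (it is the «singular-null» input of (U2-UPG), one of four sub-sockets of (HC-LI)).
-/

set_option autoImplicit false
set_option linter.dupNamespace false -- the mandated namespace repeats `HodgeConjecture.HodgeConjecture`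

noncomputable section

open MeasureTheory Measure Set Filter Topology NumberField IsDedekindDomain Polynomial
open scoped ENNReal NNReal Matrix MatrixGroups

namespace Summit.HodgeConjecture.HodgeConjecture.R90.S4

open Literature.NumberTheory.Rogawski1990 Literature.NumberTheory.Automorphic Literature.NumberTheory.Automorphic.UnitaryGroup
open Summit.HodgeConjecture.HodgeConjecture.Cruxes.H413
open Summit.HodgeConjecture.HodgeConjecture.Cruxes.H413.F0P3cCMLocalNonsplitBorelTransportU2 (placeForm_antidiagTwo_eq)

variable (L : Type) [Field L] [NumberField L] [IsCMField L] (v : HeightOneSpectrum (𝓞 ↥(maximalRealSubfield L)))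

/-! ## §1 Split places -/

/-- **At a SPLIT place the singular set of `U(Φ₂)_v` is null for every right-invariant σ-finite Borel measure `ν`.**  Every `w′ ∣ v` is split (★
`complexConj_smul_ne_of_exists`); `{¬ regular} ⊆ ⋃_{w′ ∣ v} {χ_{e_{w′} g} not separable}` (★ `separable_iff_forall_map_evalRingHom`; `(χ_g)_{w′} = χ_{e_{w′} g}` for the
`w′`-projection `e_{w′} = localSplitEquiv : U(Φ₂)_v ≃ₜ* GL₂(L_{w′})`, `Matrix.charpoly_map`), and each piece is null by ★ torus averaging I
`measure_setOf_not_separable_charpoly_eq_zero` along `s ↦ e_{w′}⁻¹ diag(s, 1)` (the `U(Φ₂)`-half of ★ `measure_setOf_not_separable_map_charpoly_endoEmbLocal_eq_zero`, verbatim).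
[cite: HarishChandra1970, Part V Lemma 42] [cite: Rogawski1990, §3.1 p. 19; §12.5 p. 182] -/
theorem measure_setOf_not_isRegularElt_u2Loc_eq_zero_of_split_of_isMulRightInvariant (hs : ∃ w : PlacesOver L v, IsCMField.complexConj L • w.1 ≠ w.1)
    [MeasurableSpace ((UnitaryGroup.cmDatum L 2 (Matrix.of fun i j : Fin 2 => if i.val + j.val + 1 = 2 then (1 : L) else 0)).Local v)]
    [BorelSpace ((UnitaryGroup.cmDatum L 2 (Matrix.of fun i j : Fin 2 => if i.val + j.val + 1 = 2 then (1 : L) else 0)).Local v)]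
    (ν : Measure ((UnitaryGroup.cmDatum L 2 (Matrix.of fun i j : Fin 2 => if i.val + j.val + 1 = 2 then (1 : L) else 0)).Local v)) [SigmaFinite ν] [ν.IsMulRightInvariant] :
    ν {g : (UnitaryGroup.cmDatum L 2 (Matrix.of fun i j : Fin 2 => if i.val + j.val + 1 = 2 then (1 : L) else 0)).Local v |
      ¬ IsRegularElt (g.val : GL (Fin 2) (UnitaryGroup.LocalRing L v))} = 0 := by
  classical
  -- the `w′`-projections `e w′ : U(Φ₂)_v ≃ₜ* GL₂(L_{w′})` (every `w′ ∣ v` is split)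
  let e : ∀ w : PlacesOver L v,
      (UnitaryGroup.cmDatum L 2 (Matrix.of fun i j : Fin 2 => if i.val + j.val + 1 = 2 then (1 : L) else 0)).Local v ≃ₜ* GL (Fin 2) (w.1.adicCompletion L) :=
    fun w => localSplitEquiv (IsCMField.complexConj L) _ (IsCMField.complexConj_ne_one L) (cm_antidiagTwo_map_transpose L) w
      (complexConj_smul_ne_of_exists L v hs w) (isUnit_placeForm_of_isUnit_det (cm_isUnit_det_antidiagTwo L) w.1)
  -- `{¬ regular} ⊆ ⋃_{w′} {χ_{e_{w′} g} not separable}`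
  have hsub : {g : (UnitaryGroup.cmDatum L 2 (Matrix.of fun i j : Fin 2 => if i.val + j.val + 1 = 2 then (1 : L) else 0)).Local v |
      ¬ IsRegularElt (g.val : GL (Fin 2) (UnitaryGroup.LocalRing L v))} ⊆
      ⋃ w : PlacesOver L v, {g | ¬ (((e w g : GL (Fin 2) (w.1.adicCompletion L)) : Matrix (Fin 2) (Fin 2) (w.1.adicCompletion L)).charpoly).Separable} := by
    intro g hg
    rw [Set.mem_setOf_eq, isRegularElt_iff, Literature.Algebra.Polynomial.separable_iff_forall_map_evalRingHom, not_forall] at hg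
    obtain ⟨w, hw⟩ := hg
    refine Set.mem_iUnion.2 ⟨w, ?_⟩
    have hmat : ((e w g : GL (Fin 2) (w.1.adicCompletion L)) : Matrix (Fin 2) (Fin 2) (w.1.adicCompletion L)) =
        ((g.val : GL (Fin 2) (UnitaryGroup.LocalRing L v)) : Matrix (Fin 2) (Fin 2) (UnitaryGroup.LocalRing L v)).map
          (Pi.evalRingHom (fun w' : PlacesOver L v => w'.1.adicCompletion L) w) := rfl
    rw [Set.mem_setOf_eq, hmat, Matrix.charpoly_map]
    exact hw
  refine measure_mono_null hsub (measure_iUnion_null fun w => ?_)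
  -- one place `w`: torus averaging I along `s ↦ (e w)⁻¹ diag(s, 1)`
  letI : NontriviallyNormedField (w.1.adicCompletion L) :=
    Valued.toNontriviallyNormedField (w.1.adicCompletion L) (WithZero (Multiplicative ℤ))
  haveI : CharZero (w.1.adicCompletion L) := charZero_of_injective_algebraMap (algebraMap L _).injective
  haveI : NeZero (2 : w.1.adicCompletion L) := inferInstance
  haveI : ProperSpace (w.1.adicCompletion L) := properSpace_adicCompletion L w.1
  letI : MeasurableSpace (w.1.adicCompletion L) := borel _
  haveI : BorelSpace (w.1.adicCompletion L) := ⟨rfl⟩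
  let π : (UnitaryGroup.cmDatum L 2 (Matrix.of fun i j : Fin 2 => if i.val + j.val + 1 = 2 then (1 : L) else 0)).Local v → Matrix (Fin 2) (Fin 2) (w.1.adicCompletion L) :=
    fun g => ((e w g : GL (Fin 2) (w.1.adicCompletion L)) : Matrix (Fin 2) (Fin 2) (w.1.adicCompletion L))
  have hπ : Continuous π := Units.continuous_val.comp (e w).continuous
  have hdet : ∀ g, (π g).det ≠ 0 := fun g => ((Matrix.isUnit_iff_isUnit_det _).mp (e w g).isUnit).ne_zero
  let D₂ : {s : w.1.adicCompletion L // s ≠ 0} → GL (Fin 2) (w.1.adicCompletion L) := fun x =>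
    ⟨Matrix.diagonal ![(x : w.1.adicCompletion L), 1], Matrix.diagonal ![(x : w.1.adicCompletion L)⁻¹, 1],
      by rw [Matrix.diagonal_mul_diagonal, ← Matrix.diagonal_one]; congr 1; funext i; fin_cases i <;> simp [x.2],
      by rw [Matrix.diagonal_mul_diagonal, ← Matrix.diagonal_one]; congr 1; funext i; fin_cases i <;> simp [x.2]⟩
  let ι₂ : w.1.adicCompletion L → (UnitaryGroup.cmDatum L 2 (Matrix.of fun i j : Fin 2 => if i.val + j.val + 1 = 2 then (1 : L) else 0)).Local v :=
    fun s => if h : s = 0 then 1 else (e w).symm (D₂ ⟨s, h⟩)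
  have hι₂m : Measurable ι₂ :=
    measurable_of_eq_on_ne_zero (f := fun x => (e w).symm (D₂ x)) ((e w).symm.continuous.comp continuous_diagUnit_two) ι₂ (fun s h => dif_neg h)
  have hι₂ : ∀ (g : (UnitaryGroup.cmDatum L 2 (Matrix.of fun i j : Fin 2 => if i.val + j.val + 1 = 2 then (1 : L) else 0)).Local v)
      (s : w.1.adicCompletion L), s ≠ 0 → π (g * ι₂ s) = π g * Matrix.diagonal ![s, 1] := by
    intro g s h
    simp only [π, ι₂, dif_neg h, map_mul, ContinuousMulEquiv.apply_symm_apply, Units.val_mul, D₂]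
  exact measure_setOf_not_separable_charpoly_eq_zero π hπ hdet ι₂ hι₂m hι₂ ν

/-- **At a SPLIT place the singular set of `U(Φ₂)_v` is HAAR-null**: a (left) Haar measure `μ` has the right-invariant σ-finite reflection `μ.inv`, and the singular set
is stable under `g ↦ g⁻¹` (★ `isRegularElt_inv_iff`), so `μ {¬ regular} = μ.inv {¬ regular} = 0`. [cite: HarishChandra1970, Part V Lemma 42] [cite: Rogawski1990, §12.5 p. 182] -/
theorem measure_setOf_not_isRegularElt_u2Loc_eq_zero_of_split (hs : ∃ w : PlacesOver L v, IsCMField.complexConj L • w.1 ≠ w.1)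
    [MeasurableSpace ((UnitaryGroup.cmDatum L 2 (Matrix.of fun i j : Fin 2 => if i.val + j.val + 1 = 2 then (1 : L) else 0)).Local v)]
    [BorelSpace ((UnitaryGroup.cmDatum L 2 (Matrix.of fun i j : Fin 2 => if i.val + j.val + 1 = 2 then (1 : L) else 0)).Local v)]
    (μ : Measure ((UnitaryGroup.cmDatum L 2 (Matrix.of fun i j : Fin 2 => if i.val + j.val + 1 = 2 then (1 : L) else 0)).Local v)) [μ.IsHaarMeasure] :
    μ {g : (UnitaryGroup.cmDatum L 2 (Matrix.of fun i j : Fin 2 => if i.val + j.val + 1 = 2 then (1 : L) else 0)).Local v |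
      ¬ IsRegularElt (g.val : GL (Fin 2) (UnitaryGroup.LocalRing L v))} = 0 := by
  have hS : {g : (UnitaryGroup.cmDatum L 2 (Matrix.of fun i j : Fin 2 => if i.val + j.val + 1 = 2 then (1 : L) else 0)).Local v |
      ¬ IsRegularElt (g.val : GL (Fin 2) (UnitaryGroup.LocalRing L v))}⁻¹ =
      {g | ¬ IsRegularElt (g.val : GL (Fin 2) (UnitaryGroup.LocalRing L v))} := by
    ext g
    simp only [Set.mem_inv, Set.mem_setOf_eq]
    exact not_congr (K2E3CharpolyDiscrInv.isRegularElt_inv_iff _)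
  have h := measure_setOf_not_isRegularElt_u2Loc_eq_zero_of_split_of_isMulRightInvariant L v hs μ.inv
  rwa [Measure.inv_apply, hS] at h

/-! ## §2 Non-split places -/

/-- **At a NON-SPLIT place the singular set of `U(Φ₂)_v` is HAAR-null**: transport of ★ p861160 `ae_isRegularElt_of_eq_over_two` on the one-place model
`U(σ_w, Φ₂)(L_w)` along ★ `localNonsplitEquiv` (`e_* μ` is a Haar measure; regularity of `g` = separability of `χ_{e g}`, ★ `isRegularElt_iff_charpoly_separable_localNonsplitEquiv`).
[cite: HarishChandra1970, Part V Lemma 42] [cite: Rogawski1990, §12.5 p. 182] [cite: PlatonovRapinchuk1994, §5.1] -/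
theorem measure_setOf_not_isRegularElt_u2Loc_eq_zero_of_nonsplit (w : PlacesOver L v) (hw : IsCMField.complexConj L • w.1 = w.1)
    [MeasurableSpace ((UnitaryGroup.cmDatum L 2 (Matrix.of fun i j : Fin 2 => if i.val + j.val + 1 = 2 then (1 : L) else 0)).Local v)]
    [BorelSpace ((UnitaryGroup.cmDatum L 2 (Matrix.of fun i j : Fin 2 => if i.val + j.val + 1 = 2 then (1 : L) else 0)).Local v)]
    (μ : Measure ((UnitaryGroup.cmDatum L 2 (Matrix.of fun i j : Fin 2 => if i.val + j.val + 1 = 2 then (1 : L) else 0)).Local v)) [μ.IsHaarMeasure] :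
    μ {g : (UnitaryGroup.cmDatum L 2 (Matrix.of fun i j : Fin 2 => if i.val + j.val + 1 = 2 then (1 : L) else 0)).Local v |
      ¬ IsRegularElt (g.val : GL (Fin 2) (UnitaryGroup.LocalRing L v))} = 0 := by
  letI : MeasurableSpace ↥(unitaryGroupOfForm (galAdicCompletionMap (L := L) (IsCMField.complexConj L) hw)
      (placeForm (Matrix.of fun i j : Fin 2 => if i.val + j.val + 1 = 2 then (1 : L) else 0) w.1)) := borel _
  haveI : BorelSpace ↥(unitaryGroupOfForm (galAdicCompletionMap (L := L) (IsCMField.complexConj L) hw)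
      (placeForm (Matrix.of fun i j : Fin 2 => if i.val + j.val + 1 = 2 then (1 : L) else 0) w.1)) := ⟨rfl⟩
  let e : (UnitaryGroup.cmDatum L 2 (Matrix.of fun i j : Fin 2 => if i.val + j.val + 1 = 2 then (1 : L) else 0)).Local v ≃ₜ*
      ↥(unitaryGroupOfForm (galAdicCompletionMap (L := L) (IsCMField.complexConj L) hw)
        (placeForm (Matrix.of fun i j : Fin 2 => if i.val + j.val + 1 = 2 then (1 : L) else 0) w.1)) :=
    localNonsplitEquiv (IsCMField.complexConj L) (Matrix.of fun i j : Fin 2 => if i.val + j.val + 1 = 2 then (1 : L) else 0)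
      (IsCMField.complexConj_ne_one L) w hw
  haveI : (μ.map e).IsHaarMeasure := ContinuousMulEquiv.isHaarMeasure_map μ e
  -- a.e. `e g` is regular (★ p861160 at the Haar measure `e_* μ`, pulled back)
  have hae : ∀ᵐ g ∂μ, IsRegularElt ((e g : ↥(unitaryGroupOfForm (galAdicCompletionMap (L := L) (IsCMField.complexConj L) hw)
      (placeForm (Matrix.of fun i j : Fin 2 => if i.val + j.val + 1 = 2 then (1 : L) else 0) w.1))) : GL (Fin 2) (w.1.adicCompletion L)) :=
    ae_of_ae_map e.continuous.measurable.aemeasurable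
      (K2E3UnitarySingularLocusNullTwo.ae_isRegularElt_of_eq_over_two L w hw (placeForm_antidiagTwo_eq L v w) (μ.map e))
  -- read back on `G` through ★ `isRegularElt_iff_charpoly_separable_localNonsplitEquiv`
  have hae' : ∀ᵐ g ∂μ, IsRegularElt (g.val : GL (Fin 2) (UnitaryGroup.LocalRing L v)) := by
    filter_upwards [hae] with g hg
    exact (isRegularElt_iff_charpoly_separable_localNonsplitEquiv (IsCMField.complexConj L) 2
      (Matrix.of fun i j : Fin 2 => if i.val + j.val + 1 = 2 then (1 : L) else 0) (IsCMField.complexConj_ne_one L) w hw g).2 hg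
  exact ae_iff.1 hae'

/-! ## §3 Every finite place -/

/-- **THE SINGULAR SET OF `U(Φ₂)(L⁺_v)` IS HAAR-NULL AT EVERY FINITE PLACE `v`** (Harish-Chandra's Lemma 42 for `U(Φ₂)_v`: §1 at split `v`, §2 at non-split `v`).
[cite: HarishChandra1970, Part V Lemma 42] [cite: Rogawski1990, §3.1 p. 19; §12.5 p. 182] -/
theorem measure_setOf_not_isRegularElt_u2Loc_eq_zero
    [MeasurableSpace ((UnitaryGroup.cmDatum L 2 (Matrix.of fun i j : Fin 2 => if i.val + j.val + 1 = 2 then (1 : L) else 0)).Local v)]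
    [BorelSpace ((UnitaryGroup.cmDatum L 2 (Matrix.of fun i j : Fin 2 => if i.val + j.val + 1 = 2 then (1 : L) else 0)).Local v)]
    (μ : Measure ((UnitaryGroup.cmDatum L 2 (Matrix.of fun i j : Fin 2 => if i.val + j.val + 1 = 2 then (1 : L) else 0)).Local v)) [μ.IsHaarMeasure] :
    μ {g : (UnitaryGroup.cmDatum L 2 (Matrix.of fun i j : Fin 2 => if i.val + j.val + 1 = 2 then (1 : L) else 0)).Local v |
      ¬ IsRegularElt (g.val : GL (Fin 2) (UnitaryGroup.LocalRing L v))} = 0 := by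
  by_cases hs : ∃ w : PlacesOver L v, IsCMField.complexConj L • w.1 ≠ w.1
  · exact measure_setOf_not_isRegularElt_u2Loc_eq_zero_of_split L v hs μ
  · obtain ⟨w⟩ := (inferInstance : Nonempty (PlacesOver L v))
    have hw : IsCMField.complexConj L • w.1 = w.1 := by
      by_contra h
      exact hs ⟨w, h⟩
    exact measure_setOf_not_isRegularElt_u2Loc_eq_zero_of_nonsplit L v w hw μ

/-- **HAAR-ALMOST EVERY ELEMENT OF `U(Φ₂)(L⁺_v)` IS REGULAR SEMISIMPLE** (every finite `v`) — the `∀ᵐ` reading of `measure_setOf_not_isRegularElt_u2Loc_eq_zero`.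
[cite: HarishChandra1970, Part V Lemma 42] [cite: Rogawski1990, §12.5 p. 182] -/
theorem ae_isRegularElt_u2Loc
    [MeasurableSpace ((UnitaryGroup.cmDatum L 2 (Matrix.of fun i j : Fin 2 => if i.val + j.val + 1 = 2 then (1 : L) else 0)).Local v)]
    [BorelSpace ((UnitaryGroup.cmDatum L 2 (Matrix.of fun i j : Fin 2 => if i.val + j.val + 1 = 2 then (1 : L) else 0)).Local v)]
    (μ : Measure ((UnitaryGroup.cmDatum L 2 (Matrix.of fun i j : Fin 2 => if i.val + j.val + 1 = 2 then (1 : L) else 0)).Local v)) [μ.IsHaarMeasure] :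
    ∀ᵐ g ∂μ, IsRegularElt ((g : (UnitaryGroup.cmDatum L 2 (Matrix.of fun i j : Fin 2 => if i.val + j.val + 1 = 2 then (1 : L) else 0)).Local v).val :
      GL (Fin 2) (UnitaryGroup.LocalRing L v)) := by
  rw [ae_iff]
  exact measure_setOf_not_isRegularElt_u2Loc_eq_zero L v μ

/-- **The regular set of `U(Φ₂)(L⁺_v)` is open and conull** — the two facts the (U2-UPG) upgrade consumes, packaged (★ `isOpen_setOf_isRegularElt_local` + §3).
[cite: HarishChandra1970, Part I §3; Part V Lemma 42] [cite: Rogawski1990, §3.1 p. 19] -/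
theorem isOpen_and_measure_compl_setOf_isRegularElt_u2Loc
    [MeasurableSpace ((UnitaryGroup.cmDatum L 2 (Matrix.of fun i j : Fin 2 => if i.val + j.val + 1 = 2 then (1 : L) else 0)).Local v)]
    [BorelSpace ((UnitaryGroup.cmDatum L 2 (Matrix.of fun i j : Fin 2 => if i.val + j.val + 1 = 2 then (1 : L) else 0)).Local v)]
    (μ : Measure ((UnitaryGroup.cmDatum L 2 (Matrix.of fun i j : Fin 2 => if i.val + j.val + 1 = 2 then (1 : L) else 0)).Local v)) [μ.IsHaarMeasure] :
    IsOpen {g : (UnitaryGroup.cmDatum L 2 (Matrix.of fun i j : Fin 2 => if i.val + j.val + 1 = 2 then (1 : L) else 0)).Local v |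
        IsRegularElt (g.val : GL (Fin 2) (UnitaryGroup.LocalRing L v))} ∧
      μ {g : (UnitaryGroup.cmDatum L 2 (Matrix.of fun i j : Fin 2 => if i.val + j.val + 1 = 2 then (1 : L) else 0)).Local v |
        IsRegularElt (g.val : GL (Fin 2) (UnitaryGroup.LocalRing L v))}ᶜ = 0 := by
  refine ⟨K2E3CharLocIntOfLocal.isOpen_setOf_isRegularElt_local L 2 _ v, ?_⟩
  rw [Set.compl_setOf]
  exact measure_setOf_not_isRegularElt_u2Loc_eq_zero L v μ

end Summit.HodgeConjecture.HodgeConjecture.R90.S4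

end
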